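import Literature.Analysis.FluidPDE.FluidComputer.SpaceGroupSymmetry
import Summits.NavierStokesRegularity.FluidComputer.TaylorGreenFamily
import Mathlib.Analysis.Calculus.IteratedDeriv.Lemmas
import HarnessLib

/-!
# Time parity of the truncated Euler system as a statement about Taylor coefficients; the
# Ohkitani family

HONEST FRAMING: typed infrastructure for a low prior, high value-of-information experiment on Tao's
machine paradigm; NOT a claim that NS blows up.

Ohkitani writes the Taylor–Green enstrophy as a series in `ξ = t²` "because `Q` is an even
function of `t` for the initial condition" [cite: Ohkitani2001ODEEnstrophy, §3.1 before eq. (24)]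
and does the same for the two-parameter family `(A, B, -(A+B))`
[cite: Ohkitani2001ODEEnstrophy, eq. (22), App. (A1)].  `SpaceGroupSymmetry` (this tree) proves the
mechanism for the Taylor–Green and Kida–Pelz data: a half-period translation reverses the datum,
`t ↦ -û(-t)` solves the truncated Euler system, and uniqueness gives `T_a û(t) = -û(-t)`
(`tg_translate_halfXYZ_eq_reverse`, `tg_modalEnergy_even`, `tg_truncEnstrophy_even`, `kp_…`).

This file adds what the cell's exact-series bookkeeping ("odd orders of `Z(t)/Z₀` are zero") uses:

* the GENERIC form `translate_eq_reverse`: any unforced Galerkin–Euler solution supported in `S`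
  whose datum satisfies `T_a û(0) = -û(0)` for some translation `a` satisfies `T_a û(t) = -û(-t)`;
  every modal energy, the truncated energy and the truncated enstrophy on ANY mode set are even
  in `t` (`modalEnergy_even`, `truncEnergy_even`, `truncEnstrophy_even`) and every mode-to-mode /
  shell-to-shell transfer is odd (`modeTransfer_odd`, `shellTransfer_odd`);
* the calculus step `iteratedDeriv_eq_zero_of_even` / `iteratedDeriv_eq_zero_of_odd`: an even (odd)
  real function has vanishing odd (even) derivatives at `0` — no differentiability hypothesis, by
  Mathlib's `iteratedDeriv_comp_neg`; hence `iteratedDeriv_truncEnstrophy_odd` (odd Taylor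
  coefficients of `t ↦ Z_T(û(t))` vanish) and `iteratedDeriv_shellTransfer_even` (even Taylor
  coefficients of `t ↦ Π_{K←P}(t)` vanish, in particular `Π(0) = 0`);
* the OHKITANI FAMILY `TaylorGreenFamily.fam A B` (modes `{±1}³`): `translate_halfX_fam`
  (`T_{(π,0,0)} fam = -fam`), hence `fam_translate_halfX_eq_reverse`, `fam_truncEnstrophy_even` and
  the headline `fam_odd_coeff_zero`: for every member, every truncation `S ⊇ modes` and every mode
  set `T`, `(d/dt)ⁿ Z_T(û(t))|_{t=0} = 0` for odd `n`;
* the same Taylor-coefficient statements for `tg` and `kp` (`tg_odd_coeff_zero`,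
  `kp_odd_coeff_zero`, `tg_transfer_even_coeff_zero`) as corollaries of the `SpaceGroupSymmetry`
  theorems.

0 sorry, 0 named facts.
-/

noncomputable section

namespace Summit.NavierStokesRegularity.FluidComputer.TimeParity

open Literature.Analysis.FluidPDE.FluidComputer
open Literature.Analysis.FluidPDE.FluidComputer.ShellTransfer
open Literature.Analysis.FluidPDE.FluidComputer.ShellTransfer.TaylorGreenHat
open Complex
open scoped BigOperators

/-! ## Calculus: parity and derivatives at the origin -/

/-- An even function `f : ℝ → ℝ` has `f⁽ⁿ⁾(0) = 0` for every odd `n` (with Mathlib's convention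
`deriv = 0` where the derivative does not exist, no differentiability hypothesis is needed).
[folklore] -/
theorem iteratedDeriv_eq_zero_of_even {f : ℝ → ℝ} (hf : ∀ x, f (-x) = f x) {n : ℕ} (hn : Odd n) :
    iteratedDeriv n f 0 = 0 := by
  have h := iteratedDeriv_comp_neg n f 0
  have e : (fun x => f (-x)) = f := funext hf
  rw [e, neg_zero, hn.neg_one_pow, smul_eq_mul] at h
  linarith

/-- An odd function `f : ℝ → ℝ` has `f⁽ⁿ⁾(0) = 0` for every even `n`. [folklore] -/
theorem iteratedDeriv_eq_zero_of_odd {f : ℝ → ℝ} (hf : ∀ x, f (-x) = -f x) {n : ℕ} (hn : Even n) :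
    iteratedDeriv n f 0 = 0 := by
  have h := iteratedDeriv_comp_neg n f 0
  have e : (fun x => f (-x)) = fun x => -f x := funext hf
  rw [e, iteratedDeriv_fun_neg, neg_zero, hn.neg_one_pow, one_smul] at h
  linarith

/-! ## Dynamics, generic form: `T_a û(t) = -û(-t)` from `T_a û(0) = -û(0)` -/

variable {U : ℝ → FourierVelocity} {S : Finset (Fin 3 → ℤ)} {c : ℝ → (Fin 3 → ℤ) → ℂ}
  {a : Fin 3 → ℝ}

/-- **TIME PARITY, GENERIC FORM.** For an unforced Galerkin–Euler solution (`ν = 0`) supported in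
`S` whose datum is reversed by the translation by `a`, `T_a û(0) = -û(0)`, the translated curve
`t ↦ T_a û(t)` and the reversed curve `t ↦ -û(-t)` coincide: both solve the truncated Euler system
(`isGalerkinSolution_translate_unforced`, `isGalerkinSolution_reverse`) and agree at `t = 0`
(`GalerkinODE.galerkin_unique`).
[cite: Ohkitani2001ODEEnstrophy, §3.1 ('Q is an even function of t for the initial condition')] -/
theorem translate_eq_reverse (hU : IsGalerkinSolution U S 0 c fun _ _ _ => 0)
    (hs : IsSupportedOn U S) (h0 : translate a (U 0) = scale (-1) (U 0)) (t : ℝ) :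
    translate a (U t) = reverse U t := by
  refine GalerkinODE.galerkin_unique S (isGalerkinSolution_translate_unforced hU a)
    (isGalerkinSolution_reverse hU) (translate_isSupportedOn a hs) (reverse_isSupportedOn hs)
    (t₀ := 0) ?_ t
  show translate a (U 0) = reverse U 0
  unfold reverse
  rw [neg_zero, h0]

/-- Every modal energy is even in time. [folklore] -/
theorem modalEnergy_even (hU : IsGalerkinSolution U S 0 c fun _ _ _ => 0) (hs : IsSupportedOn U S)
    (h0 : translate a (U 0) = scale (-1) (U 0)) (t : ℝ) (k : Fin 3 → ℤ) :
    modalEnergy (U (-t)) k = modalEnergy (U t) k := by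
  have h := congrArg (fun A => modalEnergy A k) (translate_eq_reverse hU hs h0 t)
  simp only [modalEnergy_translate, modalEnergy_reverse] at h
  exact h.symm

/-- The truncated energy on ANY mode set `T` is even in time. [folklore] -/
theorem truncEnergy_even (hU : IsGalerkinSolution U S 0 c fun _ _ _ => 0) (hs : IsSupportedOn U S)
    (h0 : translate a (U 0) = scale (-1) (U 0)) (t : ℝ) (T : Finset (Fin 3 → ℤ)) :
    truncEnergy (U (-t)) T = truncEnergy (U t) T :=
  Finset.sum_congr rfl fun k _ => modalEnergy_even hU hs h0 t k

/-- **The truncated enstrophy on ANY mode set `T` is even in time.**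
[cite: Ohkitani2001ODEEnstrophy, §3.1 ('Q is an even function of t for the initial condition')] -/
theorem truncEnstrophy_even (hU : IsGalerkinSolution U S 0 c fun _ _ _ => 0)
    (hs : IsSupportedOn U S) (h0 : translate a (U 0) = scale (-1) (U 0)) (t : ℝ)
    (T : Finset (Fin 3 → ℤ)) : truncEnstrophy (U (-t)) T = truncEnstrophy (U t) T :=
  Finset.sum_congr rfl fun k _ => by rw [modalEnergy_even hU hs h0 t k]

/-- Every mode-to-mode transfer is odd in time. [folklore] -/
theorem modeTransfer_odd (hU : IsGalerkinSolution U S 0 c fun _ _ _ => 0) (hs : IsSupportedOn U S)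
    (h0 : translate a (U 0) = scale (-1) (U 0)) (t : ℝ) (k p : Fin 3 → ℤ) :
    modeTransfer (U (-t)) k p = -modeTransfer (U t) k p := by
  have h := congrArg (fun A => modeTransfer A k p) (translate_eq_reverse hU hs h0 t)
  simp only [modeTransfer_translate, modeTransfer_reverse] at h
  linarith

/-- Every shell-to-shell transfer is odd in time. [folklore] -/
theorem shellTransfer_odd (hU : IsGalerkinSolution U S 0 c fun _ _ _ => 0) (hs : IsSupportedOn U S)
    (h0 : translate a (U 0) = scale (-1) (U 0)) (t : ℝ) (K P : Finset (Fin 3 → ℤ)) :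
    shellTransfer (U (-t)) K P = -shellTransfer (U t) K P := by
  unfold shellTransfer
  rw [← Finset.sum_neg_distrib]
  refine Finset.sum_congr rfl fun k _ => ?_
  rw [← Finset.sum_neg_distrib]
  exact Finset.sum_congr rfl fun p _ => modeTransfer_odd hU hs h0 t k p

/-! ## … as statements about Taylor coefficients at `t = 0` -/

/-- **Odd Taylor coefficients of the enstrophy vanish**: `(d/dt)ⁿ Z_T(û(t))|_{t=0} = 0` for odd `n`.
[cite: Ohkitani2001ODEEnstrophy, §3.1 eq. (24) (series in ξ = t²)] -/
theorem iteratedDeriv_truncEnstrophy_odd (hU : IsGalerkinSolution U S 0 c fun _ _ _ => 0)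
    (hs : IsSupportedOn U S) (h0 : translate a (U 0) = scale (-1) (U 0))
    (T : Finset (Fin 3 → ℤ)) {n : ℕ} (hn : Odd n) :
    iteratedDeriv n (fun t => truncEnstrophy (U t) T) 0 = 0 :=
  iteratedDeriv_eq_zero_of_even (fun t => truncEnstrophy_even hU hs h0 t T) hn

/-- Odd Taylor coefficients of the truncated energy on any mode set vanish. [folklore] -/
theorem iteratedDeriv_truncEnergy_odd (hU : IsGalerkinSolution U S 0 c fun _ _ _ => 0)
    (hs : IsSupportedOn U S) (h0 : translate a (U 0) = scale (-1) (U 0))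
    (T : Finset (Fin 3 → ℤ)) {n : ℕ} (hn : Odd n) :
    iteratedDeriv n (fun t => truncEnergy (U t) T) 0 = 0 :=
  iteratedDeriv_eq_zero_of_even (fun t => truncEnergy_even hU hs h0 t T) hn

/-- Odd Taylor coefficients of every modal energy vanish. [folklore] -/
theorem iteratedDeriv_modalEnergy_odd (hU : IsGalerkinSolution U S 0 c fun _ _ _ => 0)
    (hs : IsSupportedOn U S) (h0 : translate a (U 0) = scale (-1) (U 0))
    (k : Fin 3 → ℤ) {n : ℕ} (hn : Odd n) :
    iteratedDeriv n (fun t => modalEnergy (U t) k) 0 = 0 :=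
  iteratedDeriv_eq_zero_of_even (fun t => modalEnergy_even hU hs h0 t k) hn

/-- **Even Taylor coefficients of every shell-to-shell transfer vanish** (in particular the transfer
itself vanishes at `t = 0`). [folklore] -/
theorem iteratedDeriv_shellTransfer_even (hU : IsGalerkinSolution U S 0 c fun _ _ _ => 0)
    (hs : IsSupportedOn U S) (h0 : translate a (U 0) = scale (-1) (U 0))
    (K P : Finset (Fin 3 → ℤ)) {n : ℕ} (hn : Even n) :
    iteratedDeriv n (fun t => shellTransfer (U t) K P) 0 = 0 :=
  iteratedDeriv_eq_zero_of_odd (fun t => shellTransfer_odd hU hs h0 t K P) hn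

/-! ## The Ohkitani family `(A, B, -(A+B))` -/

/-- **`T_{(π,0,0)} (fam A B) = -(fam A B)`**: every carried wavevector of the family member has
first entry `±1`, odd. [cite: Ohkitani2001ODEEnstrophy, eq. (22)] -/
theorem translate_halfX_fam (A B : ℝ) :
    translate halfX (TaylorGreenFamily.fam A B) = scale (-1) (TaylorGreenFamily.fam A B) := by
  refine translate_halfX_eq_neg_of_odd fun k h => ?_
  by_cases hk : k ∈ modes
  · exact odd_of_mem_pmOne (mem_modes.mp hk).1
  · exact absurd (TaylorGreenFamily.coeff_of_not_mem A B hk) h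

/-- **`T_{(π,0,0)} û(t) = -û(-t)` along every inviscid run of the family.**
[cite: Ohkitani2001ODEEnstrophy, §3.1, App. (A1)] -/
theorem fam_translate_halfX_eq_reverse {A B : ℝ} (hU : IsGalerkinSolution U S 0 c fun _ _ _ => 0)
    (hs : IsSupportedOn U S) (h0 : U 0 = TaylorGreenFamily.fam A B) (t : ℝ) :
    translate halfX (U t) = reverse U t :=
  translate_eq_reverse hU hs (by rw [h0, translate_halfX_fam]) t

/-- **The truncated enstrophy of every inviscid run of the family is even in time** (any mode set).
[cite: Ohkitani2001ODEEnstrophy, App. (A1)] -/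
theorem fam_truncEnstrophy_even {A B : ℝ} (hU : IsGalerkinSolution U S 0 c fun _ _ _ => 0)
    (hs : IsSupportedOn U S) (h0 : U 0 = TaylorGreenFamily.fam A B) (t : ℝ)
    (T : Finset (Fin 3 → ℤ)) : truncEnstrophy (U (-t)) T = truncEnstrophy (U t) T :=
  truncEnstrophy_even hU hs (by rw [h0, translate_halfX_fam]) t T

/-- **HEADLINE.  Ohkitani's family `(A, B, -(A+B))`: for every member, every truncation `S` carrying
the solution and every mode set `T`, the odd time-derivatives of `t ↦ Z_T(û(t))` vanish at
`t = 0`** — the Taylor series of the truncated enstrophy is a series in `t²`.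
[cite: Ohkitani2001ODEEnstrophy, App. (A1)] -/
theorem fam_odd_coeff_zero {A B : ℝ} (hU : IsGalerkinSolution U S 0 c fun _ _ _ => 0)
    (hs : IsSupportedOn U S) (h0 : U 0 = TaylorGreenFamily.fam A B) (T : Finset (Fin 3 → ℤ))
    {n : ℕ} (hn : Odd n) : iteratedDeriv n (fun t => truncEnstrophy (U t) T) 0 = 0 :=
  iteratedDeriv_truncEnstrophy_odd hU hs (by rw [h0, translate_halfX_fam]) T hn

/-- Family: even Taylor coefficients of every shell-to-shell transfer vanish. [folklore] -/
theorem fam_transfer_even_coeff_zero {A B : ℝ} (hU : IsGalerkinSolution U S 0 c fun _ _ _ => 0)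
    (hs : IsSupportedOn U S) (h0 : U 0 = TaylorGreenFamily.fam A B) (K P : Finset (Fin 3 → ℤ))
    {n : ℕ} (hn : Even n) : iteratedDeriv n (fun t => shellTransfer (U t) K P) 0 = 0 :=
  iteratedDeriv_shellTransfer_even hU hs (by rw [h0, translate_halfX_fam]) K P hn

/-! ## Taylor–Green and Kida–Pelz (corollaries of `SpaceGroupSymmetry`) -/

/-- **Taylor–Green: odd Taylor coefficients of `Z_T(t)` vanish** (from `tg_truncEnstrophy_even`).
[cite: Ohkitani2001ODEEnstrophy, §3.1 eq. (24)] -/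
theorem tg_odd_coeff_zero (hU : IsGalerkinSolution U S 0 c fun _ _ _ => 0) (hs : IsSupportedOn U S)
    (h0 : U 0 = tg) (T : Finset (Fin 3 → ℤ)) {n : ℕ} (hn : Odd n) :
    iteratedDeriv n (fun t => truncEnstrophy (U t) T) 0 = 0 :=
  iteratedDeriv_eq_zero_of_even (fun t => tg_truncEnstrophy_even hU hs h0 t T) hn

/-- Taylor–Green: even Taylor coefficients of every shell-to-shell transfer vanish (from
`tg_shellTransfer_odd`). [folklore] -/
theorem tg_transfer_even_coeff_zero (hU : IsGalerkinSolution U S 0 c fun _ _ _ => 0)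
    (hs : IsSupportedOn U S) (h0 : U 0 = tg) (K P : Finset (Fin 3 → ℤ)) {n : ℕ} (hn : Even n) :
    iteratedDeriv n (fun t => shellTransfer (U t) K P) 0 = 0 :=
  iteratedDeriv_eq_zero_of_odd (fun t => tg_shellTransfer_odd hU hs h0 t K P) hn

/-- **Kida–Pelz: odd Taylor coefficients of `Z_T(t)` vanish** (from `translate_halfX_kp`).
[folklore] -/
theorem kp_odd_coeff_zero (hU : IsGalerkinSolution U S 0 c fun _ _ _ => 0) (hs : IsSupportedOn U S)
    (h0 : U 0 = KidaPelzHat.kp) (T : Finset (Fin 3 → ℤ)) {n : ℕ} (hn : Odd n) :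
    iteratedDeriv n (fun t => truncEnstrophy (U t) T) 0 = 0 :=
  iteratedDeriv_truncEnstrophy_odd hU hs (by rw [h0, translate_halfX_kp]) T hn

/-- Kida–Pelz: even Taylor coefficients of every shell-to-shell transfer vanish. [folklore] -/
theorem kp_transfer_even_coeff_zero (hU : IsGalerkinSolution U S 0 c fun _ _ _ => 0)
    (hs : IsSupportedOn U S) (h0 : U 0 = KidaPelzHat.kp) (K P : Finset (Fin 3 → ℤ)) {n : ℕ}
    (hn : Even n) : iteratedDeriv n (fun t => shellTransfer (U t) K P) 0 = 0 :=
  iteratedDeriv_shellTransfer_even hU hs (by rw [h0, translate_halfX_kp]) K P hn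

end Summit.NavierStokesRegularity.FluidComputer.TimeParity

end
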